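import Summits.Ventures.Crystal3D.Theorems.StickyWulffConstantNoReconstructionGainGrainAdhesion
import HarnessLib

/-!
# Two misoriented grains on the `(111)` facet: only their mutual boundary can gain

HONEST FRAMING. Part of the venture `Summits/Ventures/Crystal3D` (cell `crystal3d-full`), helper
`--supports` the crux `NoReconstructionGain` (stmt-Ventures-19144, route
`route-Ventures-StickyWulffConstant`), line `adhesion`.  Corollary of the grain rung
`barlowGrainAdhesion111` (`…GrainAdhesion`): if the overlayer `X \ P` of the `(111)` slab sample
`P` is the disjoint union of two pieces `Q₁`, `Q₂`, each contained in a rigid-motion image of a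
Barlow stacking (two grains of arbitrary words, orientations and shapes — a bicrystalline
overlayer), then
`cross(P, X \ P) ≤ D(X \ P) + #{(q₁, q₂) ∈ Q₁ × Q₂ : dist q₁ q₂ = 1} + C ρ` (`C = 2040 π`):
the ONLY possible source of reconstruction gain of a bicrystalline overlayer is the bonding across
its internal grain boundary (`twoGrainAdhesion111`).  Proof: apply the grain rung to the
sub-packings `P ∪ Q₁`, `P ∪ Q₂` and use `D(Q₁ ∪ Q₂) = D(Q₁) + D(Q₂) − e(Q₁, Q₂)`
(`contactDeficiency_sdiff_split`).

WHAT THIS IS NOT: a bound on the grain-boundary bonding `e(Q₁, Q₂)` (that is the wall-cost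
question of the route's children `GenericWallFloor` / `CoaxialWallLaw`, in overlayer form);
rung F-C1 not moved.
-/

noncomputable section

namespace Summit.Ventures.Crystal3D.Theorems

open Summit.Ventures.Crystal3D Finset Real
open Literature.MathematicalPhysics.StatisticalMechanics (barlowStacking fccStacking IsHaggSeq
  contactDeficiency)
open scoped InnerProductSpace

/-- **Bicrystalline overlayers: adhesion ≤ deficiency + internal boundary bonds.**  With `R = 4`,
`C = 2040 π`: for `ρ ≥ R`, `X ⊇ P` a finite unit packing, `P` the fcc `(111)` slab sample, and
`X \ P = Q₁ ∪ Q₂` with `Q₁`, `Q₂` disjoint and each contained in a rigid-motion image of a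
Barlow stacking:
`#{(p,q) ∈ P × (X \ P) : dist p q = 1} ≤ D(X \ P) + #{(q₁,q₂) ∈ Q₁ × Q₂ : dist q₁ q₂ = 1} + C ρ`. -/
theorem twoGrainAdhesion111 :
    ∃ R C : ℝ, 1 ≤ R ∧ ∀ ρ : ℝ, R ≤ ρ → ∀ X P : Finset (EuclideanSpace ℝ (Fin 3)),
      (∀ p ∈ X, ∀ q ∈ X, p ≠ q → 1 ≤ dist p q) → P ⊆ X →
      (∀ p, p ∈ P ↔ (p ∈ fccStacking 1 (Real.sqrt (2 / 3)) ∧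
        -(2 * R) ≤ ⟪p, EuclideanSpace.single (2 : Fin 3) (1 : ℝ)⟫_ℝ ∧
        ⟪p, EuclideanSpace.single (2 : Fin 3) (1 : ℝ)⟫_ℝ ≤ -R ∧
        ‖p‖ ^ 2 - ⟪p, EuclideanSpace.single (2 : Fin 3) (1 : ℝ)⟫_ℝ ^ 2 ≤ ρ ^ 2)) →
      ∀ Q₁ Q₂ : Finset (EuclideanSpace ℝ (Fin 3)), Disjoint Q₁ Q₂ → X \ P = Q₁ ∪ Q₂ →
      (∃ (A : EuclideanSpace ℝ (Fin 3) ≃ₗᵢ[ℝ] EuclideanSpace ℝ (Fin 3))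
          (t : EuclideanSpace ℝ (Fin 3)) (σ : ℤ → ℤ), IsHaggSeq σ ∧
          (↑Q₁ : Set (EuclideanSpace ℝ (Fin 3))) ⊆
            (fun p => A p + t) '' barlowStacking 1 (Real.sqrt (2 / 3)) σ) →
      (∃ (A : EuclideanSpace ℝ (Fin 3) ≃ₗᵢ[ℝ] EuclideanSpace ℝ (Fin 3))
          (t : EuclideanSpace ℝ (Fin 3)) (σ : ℤ → ℤ), IsHaggSeq σ ∧
          (↑Q₂ : Set (EuclideanSpace ℝ (Fin 3))) ⊆
            (fun p => A p + t) '' barlowStacking 1 (Real.sqrt (2 / 3)) σ) →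
      ((((P ×ˢ (X \ P)).filter fun pq => dist pq.1 pq.2 = 1).card : ℕ) : ℝ) ≤
        contactDeficiency (X \ P) +
          ((((Q₁ ×ˢ Q₂).filter fun qq => dist qq.1 qq.2 = 1).card : ℕ) : ℝ) + C * ρ := by
  classical
  obtain ⟨R, C₀, hR, hgrain⟩ := barlowGrainAdhesion111
  refine ⟨R, 2 * C₀, hR, ?_⟩
  intro ρ hρ X P hX hPX hP Q₁ Q₂ hdisj hQ hQ₁ hQ₂
  -- the two sub-packings `P ∪ Qᵢ`
  have hPQ₁ : Disjoint P Q₁ := by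
    rw [disjoint_left]; intro p hp hp1
    have : p ∈ X \ P := by rw [hQ]; exact mem_union_left _ hp1
    exact (mem_sdiff.1 this).2 hp
  have hPQ₂ : Disjoint P Q₂ := by
    rw [disjoint_left]; intro p hp hp2
    have : p ∈ X \ P := by rw [hQ]; exact mem_union_right _ hp2
    exact (mem_sdiff.1 this).2 hp
  have hQ₁X : Q₁ ⊆ X := fun q hq => by
    have : q ∈ X \ P := by rw [hQ]; exact mem_union_left _ hq
    exact (mem_sdiff.1 this).1
  have hQ₂X : Q₂ ⊆ X := fun q hq => by
    have : q ∈ X \ P := by rw [hQ]; exact mem_union_right _ hq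
    exact (mem_sdiff.1 this).1
  have hsub : ∀ {Y : Finset (EuclideanSpace ℝ (Fin 3))}, Y ⊆ X →
      ∀ p ∈ Y, ∀ q ∈ Y, p ≠ q → 1 ≤ dist p q :=
    fun hY p hp q hq hpq => hX p (hY hp) q (hY hq) hpq
  have hsd₁ : (P ∪ Q₁) \ P = Q₁ := by
    rw [union_sdiff_left, Finset.sdiff_eq_self_iff_disjoint]; exact hPQ₁.symm
  have hsd₂ : (P ∪ Q₂) \ P = Q₂ := by
    rw [union_sdiff_left, Finset.sdiff_eq_self_iff_disjoint]; exact hPQ₂.symm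
  have h₁ := hgrain ρ hρ (P ∪ Q₁) P (hsub (union_subset hPX hQ₁X)) subset_union_left hP
    (by rw [hsd₁]; exact hQ₁)
  have h₂ := hgrain ρ hρ (P ∪ Q₂) P (hsub (union_subset hPX hQ₂X)) subset_union_left hP
    (by rw [hsd₂]; exact hQ₂)
  rw [hsd₁] at h₁
  rw [hsd₂] at h₂
  -- the cross count splits over `Q₁ ∪ Q₂`
  have hcross : (((P ×ˢ (X \ P)).filter fun pq => dist pq.1 pq.2 = 1).card : ℕ) =
      ((P ×ˢ Q₁).filter fun pq => dist pq.1 pq.2 = 1).card +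
        ((P ×ˢ Q₂).filter fun pq => dist pq.1 pq.2 = 1).card := by
    rw [hQ, product_union, filter_union, card_union_of_disjoint]
    exact disjoint_filter_filter ((disjoint_product).2 (Or.inr hdisj))
  -- the deficiency splits up to the internal boundary bonds
  have hQ₁Q : Q₁ ⊆ X \ P := by rw [hQ]; exact subset_union_left
  have hsplit := contactDeficiency_sdiff_split hQ₁Q
  have hsd : (X \ P) \ Q₁ = Q₂ := by
    rw [hQ, union_sdiff_left, Finset.sdiff_eq_self_iff_disjoint]; exact hdisj.symm
  rw [hsd] at hsplit
  push_cast [hcross]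
  linarith

end Summit.Ventures.Crystal3D.Theorems

end
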